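import Summits.BirchSwinnertonDyer.BirchSwinnertonDyer.Theorems.ByReductionTypeAtTwoSupersingularSharpTwo
import Literature.NumberTheory.EllipticCurves.AnalyticRankOrderProofs
import Literature.NumberTheory.EllipticCurves.AnalyticRankModularityProofs
import Literature.NumberTheory.EllipticCurves.Rank1Residual.Predicates
import HarnessLib

/-!
# Stub `stub_pollackPairSupplyAtTwo` of line `sign-dichotomy` of the crux `SignedMuSeedAtTwoPlus` (stmt-BirchSwinnertonDyer-21438;
# = `stub_residualSeedAtTwo` of Kμ⁺ stmt-BirchSwinnertonDyer-20689 BY NAME) — the HABITAT CASE: a Pollack pair at `2` EXISTS for the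
# newform of every `W/ℚ` of analytic rank `0`, good supersingular at `2` with `a₂ = 0`
# (width seat bsd-wall-rtt-p4-w3 g6; `--supports stmt-BirchSwinnertonDyer-21438`; closes nothing)

HONEST FRAMING. THEOREMS ONLY (no `def`, no named fact, no `sorry`); BSD is not proved by any of this. The registered stub
`stub_pollackPairSupplyAtTwo : PollackPairSupplyAtTwo` of `Cruxes/SignedMuSeedAtTwoPlus/Lines/sign_dichotomy.lean` (skeleton of
record of 21438) reads «`GoodSS W 2 → a₂(W) = 0 → ∃ N f, IsNewformOf W f ∧ ∃ L⁺ L⁻, IsPollackPair f 2 L⁺ L⁻`» for EVERY such `W`.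
`IsPollackPair` demands `L⁺ ≠ 0 ∧ L⁻ ≠ 0`; the tree's supply `exists_isPollackPair_two` (Sprung's pair at `2`, GEN 0 of route
`ByReductionTypeAtTwo`) proves this non-vanishing from `L(W,1) ≠ 0`. Off analytic rank `0` the non-vanishing of `L^♯, L^♭` is
Rohrlich's theorem on twisted `L`-values (not in the tree), so the stub AS REGISTERED is not closable from the tree today; ON THE
HABITAT⁺ (analytic rank `0`, the only place the line uses it) it is the theorem below, modulo MODULARITY (`exists_isNewformOf`,
Breuil–Conrad–Diamond–Taylor, a named fact) for the existence of the newform.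

* `pollackPairSupplyAtTwo_of_isNewformOf` — given the newform `f` of `W` (analytic rank `0`, `GoodSS W 2`, `a₂ = 0`):
  `∃ L⁺ L⁻, IsPollackPair f 2 L⁺ L⁻` (`exists_isPollackPair_two` + `analyticRank_eq_zero_iff_holds`).
* `pollackPairSupplyAtTwo_habitat_of_modularity` — `exists_isNewformOf →` the stub's conclusion for every `W` of analytic rank `0`
  with `GoodSS W 2`, `a₂ = 0` (CONDITIONAL on the modularity fact; the registered stub's text with `W.analyticRank = 0` added).

References: [Sprung2017] §1.1, Thm. 1.12, Cor. 4.4; [Pollack2003] Prop. 6.18; [DiamondShurman2005] Thm. 8.8.3; [BirchSwinnertonDyer1965].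
-/

set_option autoImplicit false
-- D-0017: single-problem summit, so `Summit.BirchSwinnertonDyer.BirchSwinnertonDyer.…` repeats a namespace BY DESIGN.
set_option linter.dupNamespace false

noncomputable section

open scoped Classical ModularForm

open CongruenceSubgroup WeierstrassCurve Literature.NumberTheory.EllipticCurves
  Literature.NumberTheory.EllipticCurves.ModularForms Literature.NumberTheory.EllipticCurves.IwasawaAlgebra
  Literature.NumberTheory.EllipticCurves.Rank1Residual
  Summit.BirchSwinnertonDyer.Rank1Residual.Supersingular

namespace Summit.BirchSwinnertonDyer.BirchSwinnertonDyer.Theorems.SignedMuAtTwo.SignDichotomy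

/-- **A Pollack pair at `2` exists for the newform of a habitat⁺-type curve**: `W/ℚ` globally minimal of analytic rank `0`, good
supersingular at `2` with `a₂(W) = 0`, `f` its newform ⇒ `∃ L⁺ L⁻, IsPollackPair f 2 L⁺ L⁻` (Sprung's `♯/♭` pair at `2` is a
Pollack pair when `a₂ = 0`; non-vanishing from `L(W,1) ≠ 0`, i.e. from analytic rank `0` since `L(W,s)` is entire for modular `W`).
[cite: Sprung2017, §1.1, Thm. 1.12 and Cor. 4.4] [cite: Pollack2003, Prop. 6.18] [cite: BirchSwinnertonDyer1965] -/
theorem pollackPairSupplyAtTwo_of_isNewformOf (W : WeierstrassCurve ℚ) [W.IsElliptic] [W.IsGloballyMinimal]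
    (hr : W.analyticRank = 0) (hss : GoodSS W 2) (ha : W.frobeniusTrace 2 = 0)
    {N : ℕ} [NeZero N] (f : CuspForm (Gamma0 N) 2) (hf : IsNewformOf W f) :
    ∃ Lplus Lminus : IwasawaAlgebra 2, IsPollackPair f 2 Lplus Lminus := by
  have hL : W.entireLFunction 1 ≠ 0 :=
    (WeierstrassCurve.analyticRank_eq_zero_iff_holds (W := W)
      (W.hasEntireLFunction_of_cuspCoeff_eq (strictWidthInfty_Gamma0 N) f hf.2)).mp hr
  obtain ⟨Ls, Lf, -, hP⟩ := Theorems.exists_isPollackPair_two hf hss.1 ha hL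
  exact ⟨Ls, Lf, hP⟩

/-- **`PollackPairSupplyAtTwo` on the habitat⁺, modulo modularity**: granted `exists_isNewformOf` (Breuil–Conrad–Diamond–Taylor,
named fact), every `W/ℚ` globally minimal of analytic rank `0`, good supersingular at `2` with `a₂ = 0`, has a newform `f` of level
`N_W` with a Pollack pair at `2` — the registered stub's conclusion, with the (necessary for the tree's supply) hypothesis
`W.analyticRank = 0` added. [cite: DiamondShurman2005, Thm. 8.8.3] [cite: Sprung2017, §1.1, Thm. 1.12 and Cor. 4.4] [cite: Pollack2003, Prop. 6.18] -/
theorem pollackPairSupplyAtTwo_habitat_of_modularity (hmod : exists_isNewformOf) :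
    ∀ (W : WeierstrassCurve ℚ) [W.IsElliptic] [W.IsGloballyMinimal], W.analyticRank = 0 → GoodSS W 2 →
      W.frobeniusTrace 2 = 0 →
      ∃ (N : ℕ) (_ : NeZero N) (f : CuspForm (Gamma0 N) 2), IsNewformOf W f ∧
        ∃ (Lplus Lminus : IwasawaAlgebra 2), IsPollackPair f 2 Lplus Lminus := by
  intro W _ _ hr hss ha
  haveI : NeZero (W.conductorNorm ℤ) := ⟨(W.conductorNorm_pos_holds).ne'⟩
  obtain ⟨f, hf⟩ := hmod W
  exact ⟨W.conductorNorm ℤ, inferInstance, f, hf, pollackPairSupplyAtTwo_of_isNewformOf W hr hss ha f hf⟩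

end Summit.BirchSwinnertonDyer.BirchSwinnertonDyer.Theorems.SignedMuAtTwo.SignDichotomy

end
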